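import Mathlib
import HarnessLib
import Summits.ABC.ABC.Theses.TwistAmplification
import Summits.ABC.ABC.Theorems.TwistAmplificationSomeWindowSavingInertBox
import Summits.ABC.ABC.Theorems.TwistAmplificationSomeWindowSavingRealPeriodUpperBound
import Summits.ABC.ABC.Theorems.TwistAmplificationSomeWindowSavingCofiniteOfPeriodBounds
import Summits.ABC.ABC.Theorems.TwistAmplificationSomeWindowSavingSublevelSmall
import Summits.ABC.ABC.Theorems.TwistAmplificationSomeWindowSavingSublevelSqrt
import Summits.ABC.ABC.Theorems.TwistAmplificationSomeWindowSavingNormalizedPeriodIntegral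
import Literature.NumberTheory.EllipticCurves.RealPeriod
import Literature.NumberTheory.EllipticCurves.AnalyticRank
import Literature.NumberTheory.EllipticCurves.QuadraticTwist
import Literature.NumberTheory.DiophantineGeometry.Conductor

/-!
# Line `Sketch` — crux `SomeWindowSaving` (stmt-ABC-1976): skeleton of the LEAD (a2), card A spine

Source: `Cruxes/SomeWindowSaving/SketchIdeator5.lean` (round-2 ideator 5), card A =
`Ideas/period-quantisation-rank-zero-twist.md` (period quantisation through one analytic-rank-zero
twist).  Card B of the same sketch (`solvable-semistable-base-change`) is NOT staffed here: none of
its three statements is provable with the present tree API (B2 `SemistabilisingField` is an XL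
formalisation of Krasner + weak approximation, B3 needs base-change invariance of the stable Faltings
height which the tree does not have, B1 `WGSOverTotallyReal` ⊇ WGS for semistable curves over `ℚ`,
open); it stays on file in the crux directory as the fallback entry.

## Status after wave 1 (lead a2, 2026-08-16): B1 p103472, B2 p102920, C p103721, D p102858, E p102705
ALL LANDED, CAL p106567 LANDED — A0 and its converse are unconditional tree theorems; the ONLY `sorry` left in
this file is the open core K1 (`stub_polyAlgebraicPart`), the hypothesis of `SomeWindowSaving_of`.

## Composition (kernel-checked here; `sorry` only inside `stub_*`)

  `stub_sublevelSmall` (B1) ─┐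
  `stub_sublevelSqrt`  (B2) ─┴─> `stub_normalizedPeriodIntegral` (C) ─> `stub_realPeriodUpperBound` (D = A0)
                                                                              │
  `stub_polyAlgebraicPart` (K1, OPEN CORE, the lead's) ─> `periodLowerBound_of_polyAlgebraicPart` (PROVED)
                                                                              │
                                   `stub_cofiniteOfPeriodBounds` (E) <────────┘
                                              │
          LANDED `Summit.ABC.ABC.Theorems.someWindowSaving_of_cofiniteWeakGenSzpiro` (InertBox, δ = 0)
                                              │
                                      `SomeWindowSaving_of hK1 : SomeWindowSaving`

* A0 = `RealPeriodUpperBound`: `Ω(W₀) ≤ C₀ · (M⁺)^{-1/12} · log(2 + M⁺)` for every integral model with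
  `Δ ≠ 0` (`Ω = (W₀ ⊗ ℝ).realPeriod = 2∫_{ψ>0} dx/√ψ`, `M⁺ = max(|Δ|,|c₄|³)`).  ROOT-FREE PROOF PLAN
  (the lead's reshape of the ideator's "compactness in j"): shift `x = t − b₂/12` and scale `t = H s`,
  `H⁶ = max(|g₂|³, g₃²)`, `g₂ = c₄/12`, `g₃ = c₆/216`, giving `Ω = 2 H^{-1/2} ∫_{p>0} ds/√p` for the
  NORMALIZED cubic `p(s) = 4s³ − G₂ s − G₃`, `max(|G₂|³, G₃²) = 1`, whose discriminant is
  `D = G₂³ − 27 G₃² = Δ/H⁶`, `|D| ≥ 1/M⁺` (integrality!), `H⁶ ≤ M⁺ ≤ 1728 H⁶`.  The normalized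
  integral is `≤ A + B |log|D||` by a dyadic (layer-cake) decomposition of `{0 < p < 1} ∩ [−2,2]`
  and two SUBLEVEL-SET estimates: (B1) `|{0<p<η}| ≤ C₁ η/|D|` for `η ≤ c₁|D|`, from the resultant
  identity `(−18G₂s+27G₃)·p + (6G₂s²−9G₃s−G₂²)·p' = D` (so `|p'| ≥ |D|/86` where `|p| ≤ |D|/126`)
  and monotonicity of `p` on the ≤ 3 pieces cut by `p' = 12s² − G₂`; (B2) `|{0<p<η}| ≤ C₂ √η` for
  `η ≤ η₀`, from the exact finite differences of a cubic (`p(m+h)+p(m−h)−2p(m) = 24 m h²`,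
  `p(m+h)−p(m−h) = 2h(12m²−G₂) + 8h³`) and the normalization (no triple root).  Then
  `Σ_k 2^{(k+1)/2} min(4, C₂ 2^{-k/2}, C₁ 2^{-k}/|D|) ≤ A + B log(1/|D|)`.
* E = `RealPeriodUpperBound → PeriodLowerBound → CofiniteWeakGenSzpiro` (bookkeeping with
  `log(2+M) ≤ 24·(3M)^{1/24}`).
* K1 = `PolyAlgebraicPart` — THE OPEN CORE (weak-abc strength: K1 ⟹ PeriodLowerBound ⟹(A0) cofinite
  weak generalized Szpiro ⟺ crux, `Disproof.lean` §1; conversely cofinite WGS + A2 + A3 + the converse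
  of A0 give K1 — a transfer to an equivalent form, said plainly by the ideator).  Held by the lead.

Everything enters the crux through the landed InertBox (witness `δ = 0`, `κ = K'+1 ≥ 8`), hence outside
every refuted strengthening of `Disproof.lean` §3/§3' (all about `κ < 4` or `σ ≤ 6`).
-/

noncomputable section

set_option linter.dupNamespace false

open WeierstrassCurve IsDedekindDomain MeasureTheory
open Summit.ABC.ABC.Theses.TwistAmplification

namespace Summit.ABC.ABC.Cruxes.SomeWindowSaving.Sketch

/-! ## Vocabulary (local abbreviations; the registered stubs below are spelled out in full) -/

/-- Conductor `N` of the generic fibre of an integral model, as a real number. -/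
abbrev condR (W₀ : WeierstrassCurve ℤ) : ℝ := (((W₀.baseChange ℚ).conductorNorm ℤ : ℕ) : ℝ)

/-- `M⁺ = max(|Δ|, |c₄|³)` of an integral model, as a real number. -/
abbrev maxInvR (W₀ : WeierstrassCurve ℤ) : ℝ := ((max |W₀.Δ| (|W₀.c₄| ^ 3) : ℤ) : ℝ)

/-- The real period `Ω(W₀) = 2 ∫_{ψ>0} dx/√ψ` of the integral model viewed over `ℝ`. -/
abbrev realPeriodZ (W₀ : WeierstrassCurve ℤ) : ℝ := (W₀.baseChange ℝ).realPeriod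

/-- The central value `L(W,1)` (real part of the entire continuation at `1`). -/
abbrev centralValue (W : WeierstrassCurve ℚ) : ℝ := (W.entireLFunction 1).re

/-- The quadratic twist `E_D` of the generic fibre. -/
abbrev twistQ (W₀ : WeierstrassCurve ℤ) (D : ℤ) : WeierstrassCurve ℚ :=
  (W₀.baseChange ℚ).quadraticTwist (D : ℚ)

/-- Admissible twisting parameter: positive squarefree `D ≡ 1 (mod 4)` prime to `6N`. -/
abbrev Admissible (W₀ : WeierstrassCurve ℤ) (D : ℤ) : Prop :=
  0 < D ∧ Squarefree D ∧ D ≡ 1 [ZMOD 4] ∧ IsCoprime D (6 * ((W₀.baseChange ℚ).conductorNorm ℤ : ℤ))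

/-- The normalized two-torsion cubic `p(s) = 4s³ − G₂ s − G₃`. -/
abbrev npoly (G₂ G₃ s : ℝ) : ℝ := 4 * s ^ 3 - G₂ * s - G₃

/-- The sublevel slice `{s ∈ [−2,2] : 0 < p(s) < η}`. -/
abbrev slSet (G₂ G₃ η : ℝ) : Set ℝ :=
  {s : ℝ | s ∈ Set.Icc (-2 : ℝ) 2 ∧ 0 < 4 * s ^ 3 - G₂ * s - G₃ ∧ 4 * s ^ 3 - G₂ * s - G₃ < η}

/-! ## The statements (Props) -/

/-- (B1) first-derivative sublevel estimate for bounded cubics `4s³ − G₂s − G₃`, `|G₂|,|G₃| ≤ 1`. -/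
def SublevelSmall : Prop :=
  ∃ c₁ C₁ : ℝ, 0 < c₁ ∧ 0 < C₁ ∧ ∀ G₂ G₃ η : ℝ, |G₂| ≤ 1 → |G₃| ≤ 1 → 0 < η →
    η ≤ c₁ * |G₂ ^ 3 - 27 * G₃ ^ 2| →
      volume {s : ℝ | s ∈ Set.Icc (-2 : ℝ) 2 ∧ 0 < 4 * s ^ 3 - G₂ * s - G₃ ∧
          4 * s ^ 3 - G₂ * s - G₃ < η} ≤
        ENNReal.ofReal (C₁ * η / |G₂ ^ 3 - 27 * G₃ ^ 2|)

/-- (B2) square-root sublevel estimate for NORMALIZED cubics (`|G₂| = 1 ∨ |G₃| = 1`). -/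
def SublevelSqrt : Prop :=
  ∃ η₀ C₂ : ℝ, 0 < η₀ ∧ 0 < C₂ ∧ ∀ G₂ G₃ η : ℝ, |G₂| ≤ 1 → |G₃| ≤ 1 → (|G₂| = 1 ∨ |G₃| = 1) →
    0 < η → η ≤ η₀ →
      volume {s : ℝ | s ∈ Set.Icc (-2 : ℝ) 2 ∧ 0 < 4 * s ^ 3 - G₂ * s - G₃ ∧
          4 * s ^ 3 - G₂ * s - G₃ < η} ≤ ENNReal.ofReal (C₂ * Real.sqrt η)

/-- (C) the normalized period integral is `≤ A + B·|log |D||`. -/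
def NormalizedPeriodBound : Prop :=
  ∃ A B : ℝ, 0 ≤ A ∧ 0 ≤ B ∧ ∀ G₂ G₃ : ℝ, |G₂| ≤ 1 → |G₃| ≤ 1 → (|G₂| = 1 ∨ |G₃| = 1) →
    G₂ ^ 3 - 27 * G₃ ^ 2 ≠ 0 →
      ∫ s in {s : ℝ | 0 < 4 * s ^ 3 - G₂ * s - G₃}, (Real.sqrt (4 * s ^ 3 - G₂ * s - G₃))⁻¹ ≤
        A + B * |Real.log (|G₂ ^ 3 - 27 * G₃ ^ 2|)|

/-- (A0) real-period upper bound for integral models. -/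
def RealPeriodUpperBound : Prop :=
  ∃ C₀ : ℝ, ∀ W₀ : WeierstrassCurve ℤ, W₀.Δ ≠ 0 →
    (W₀.baseChange ℝ).realPeriod ≤
      C₀ * ((max |W₀.Δ| (|W₀.c₄| ^ 3) : ℤ) : ℝ) ^ (-(1 : ℝ) / 12) *
        Real.log (2 + ((max |W₀.Δ| (|W₀.c₄| ^ 3) : ℤ) : ℝ))

/-- (A1) period lower bound: the real period of a minimal model is `≥ C·N^{-K}`. -/
def PeriodLowerBound : Prop :=
  ∃ K C : ℝ, 0 < C ∧ ∀ W₀ : WeierstrassCurve ℤ, (W₀.baseChange ℚ).IsElliptic →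
    (∀ v : HeightOneSpectrum ℤ, (W₀.baseChange ℚ).IsMinimalAt v) →
      C * (((W₀.baseChange ℚ).conductorNorm ℤ : ℕ) : ℝ) ^ (-K) ≤ (W₀.baseChange ℝ).realPeriod

/-- Cofinite weak generalized Szpiro — LITERALLY the hypothesis of the landed
`Summit.ABC.ABC.Theorems.someWindowSaving_of_cofiniteWeakGenSzpiro`. -/
def CofiniteWeakGenSzpiro : Prop :=
  ∃ K N₀ : ℝ, ∀ W₀ : WeierstrassCurve ℤ, (W₀.baseChange ℚ).IsElliptic →
    (∀ v : HeightOneSpectrum ℤ, (W₀.baseChange ℚ).IsMinimalAt v) → W₀.c₄ ≠ 0 → W₀.c₆ ≠ 0 →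
      N₀ ≤ (((W₀.baseChange ℚ).conductorNorm ℤ : ℕ) : ℝ) →
        ((max |W₀.Δ| (|W₀.c₄| ^ 3) : ℤ) : ℝ) ≤ (((W₀.baseChange ℚ).conductorNorm ℤ : ℕ) : ℝ) ^ K

/-- Weak generalized Szpiro WITH A CONSTANT for ALL minimal models — LITERALLY the hypothesis of the
landed `Summit.ABC.ABC.Theorems.someWindowSaving_of_weakGenSzpiro`. -/
def WeakGeneralizedSzpiro : Prop :=
  ∃ K C : ℝ, ∀ W₀ : WeierstrassCurve ℤ, (W₀.baseChange ℚ).IsElliptic →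
    (∀ v : HeightOneSpectrum ℤ, (W₀.baseChange ℚ).IsMinimalAt v) →
      ((max |W₀.Δ| (|W₀.c₄| ^ 3) : ℤ) : ℝ) ≤ C * (((W₀.baseChange ℚ).conductorNorm ℤ : ℕ) : ℝ) ^ K

/-- (K1) `PolyAlgebraicPart` — THE OPEN CORE: some small admissible twist with a not-too-small
central value has a polynomially bounded algebraic part `a` in `m·L(E_D,1)·√D = a·Ω(E)`. -/
def PolyAlgebraicPart : Prop :=
  ∃ A B K C : ℝ, 0 < C ∧ ∀ W₀ : WeierstrassCurve ℤ, (W₀.baseChange ℚ).IsElliptic →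
    (∀ v : HeightOneSpectrum ℤ, (W₀.baseChange ℚ).IsMinimalAt v) →
      ∃ D : ℤ, (0 < D ∧ Squarefree D ∧ D ≡ 1 [ZMOD 4] ∧
          IsCoprime D (6 * ((W₀.baseChange ℚ).conductorNorm ℤ : ℤ))) ∧
        (D : ℝ) ≤ (((W₀.baseChange ℚ).conductorNorm ℤ : ℕ) : ℝ) ^ A ∧
        (((W₀.baseChange ℚ).conductorNorm ℤ : ℕ) : ℝ) ^ (-B) ≤
          (((W₀.baseChange ℚ).quadraticTwist (D : ℚ)).entireLFunction 1).re ∧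
        ∃ (m : ℕ) (a : ℤ), 0 < m ∧
          (m : ℝ) * (((W₀.baseChange ℚ).quadraticTwist (D : ℚ)).entireLFunction 1).re *
              Real.sqrt D = a * (W₀.baseChange ℝ).realPeriod ∧
          (|a| : ℝ) ≤ C * (((W₀.baseChange ℚ).conductorNorm ℤ : ℕ) : ℝ) ^ K

/-! ## `CalInline`: verbatim copy of the LANDED calibration file (p106567,
`Theorems/TwistAmplificationSomeWindowSavingPeriodCalibration.lean`, namespace `Summit.ABC.ABC.Theorems`), inlined
only because the farm had not rebuilt that module at publication time; nothing here is new. -/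
namespace CalInline

open Set



/-- The two-torsion polynomial of the real model `y² = x³ − (G₂/4)x − G₃/4` evaluates to
`4s³ − G₂s − G₃`. -/
theorem sketchLower_eval (G₂ G₃ s : ℝ) :
    (⟨0, 0, 0, -G₂ / 4, -G₃ / 4⟩ : WeierstrassCurve ℝ).twoTorsionPolynomial.toPoly.eval s =
      4 * s ^ 3 - G₂ * s - G₃ := by
  rw [WeierstrassCurve.eval_twoTorsionPolynomial]
  simp only [WeierstrassCurve.b₂, WeierstrassCurve.b₄, WeierstrassCurve.b₆]
  ring

/-- The discriminant of the real model `y² = x³ − (G₂/4)x − G₃/4` is `G₂³ − 27G₃²`. -/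
theorem sketchLower_Δ (G₂ G₃ : ℝ) :
    (⟨0, 0, 0, -G₂ / 4, -G₃ / 4⟩ : WeierstrassCurve ℝ).Δ = G₂ ^ 3 - 27 * G₃ ^ 2 := by
  simp only [WeierstrassCurve.Δ, WeierstrassCurve.b₂, WeierstrassCurve.b₄, WeierstrassCurve.b₆,
    WeierstrassCurve.b₈]
  ring

/-- The two-torsion set of the real model `y² = x³ − (G₂/4)x − G₃/4` is
`{s | 0 < 4s³ − G₂s − G₃}`. -/
theorem sketchLower_twoTorsionSet (G₂ G₃ : ℝ) :
    (⟨0, 0, 0, -G₂ / 4, -G₃ / 4⟩ : WeierstrassCurve ℝ).twoTorsionSet =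
      {s : ℝ | 0 < 4 * s ^ 3 - G₂ * s - G₃} := by
  ext s
  rw [WeierstrassCurve.mem_twoTorsionSet_iff, sketchLower_eval]
  rfl

/-- Integrability of `1/√p` on `{p > 0}` for the normalized cubic with non-zero discriminant
(from `WeierstrassCurve.integrableOn_inv_sqrt_twoTorsionPolynomial'`). -/
theorem sketchLower_integrableOn (G₂ G₃ : ℝ) (hD : G₂ ^ 3 - 27 * G₃ ^ 2 ≠ 0) :
    IntegrableOn (fun s : ℝ => (Real.sqrt (4 * s ^ 3 - G₂ * s - G₃))⁻¹)
      {s : ℝ | 0 < 4 * s ^ 3 - G₂ * s - G₃} := by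
  haveI : (⟨0, 0, 0, -G₂ / 4, -G₃ / 4⟩ : WeierstrassCurve ℝ).IsElliptic :=
    ⟨isUnit_iff_ne_zero.mpr (by rw [sketchLower_Δ]; exact hD)⟩
  have h :=
    (⟨0, 0, 0, -G₂ / 4, -G₃ / 4⟩ : WeierstrassCurve ℝ).integrableOn_inv_sqrt_twoTorsionPolynomial'
  rw [sketchLower_twoTorsionSet] at h
  refine h.congr_fun (fun s _ => ?_) (measurableSet_lt measurable_const (by fun_prop))
  simp only [sketchLower_eval]

/-- **Lower bound for the normalized period integral.**  For `|G₂|, |G₃| ≤ 1` and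
`G₂³ − 27G₃² ≠ 0`: `1/2 ≤ ∫_{p>0} ds/√p(s)` where `p(s) = 4s³ − G₂s − G₃`. [folklore] -/
theorem normalizedPeriodIntegral_lower (G₂ G₃ : ℝ) (hG₂ : |G₂| ≤ 1) (hG₃ : |G₃| ≤ 1)
    (hD : G₂ ^ 3 - 27 * G₃ ^ 2 ≠ 0) :
    (1 / 2 : ℝ) ≤
      ∫ s in {s : ℝ | 0 < 4 * s ^ 3 - G₂ * s - G₃}, (Real.sqrt (4 * s ^ 3 - G₂ * s - G₃))⁻¹ := by
  set f : ℝ → ℝ := fun s => (Real.sqrt (4 * s ^ 3 - G₂ * s - G₃))⁻¹ with hf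
  have hG₂' := abs_le.mp hG₂
  have hG₃' := abs_le.mp hG₃
  -- `Ioi 1 ⊆ {p > 0}`
  have hsub : Ioi (1 : ℝ) ⊆ {s : ℝ | 0 < 4 * s ^ 3 - G₂ * s - G₃} := by
    intro s hs
    simp only [mem_Ioi] at hs
    simp only [mem_setOf_eq]
    nlinarith [mul_pos (by linarith : (0 : ℝ) < s) (by nlinarith : (0 : ℝ) < s ^ 2)]
  have hint : IntegrableOn f {s : ℝ | 0 < 4 * s ^ 3 - G₂ * s - G₃} := sketchLower_integrableOn G₂ G₃ hD
  have hf_nn : ∀ s, 0 ≤ f s := fun s => inv_nonneg.mpr (Real.sqrt_nonneg _)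
  -- restrict to `Ioi 1`
  have h1 : ∫ s in Ioi (1 : ℝ), f s ≤ ∫ s in {s : ℝ | 0 < 4 * s ^ 3 - G₂ * s - G₃}, f s :=
    setIntegral_mono_set hint (Filter.Eventually.of_forall hf_nn)
      (Filter.Eventually.of_forall hsub)
  -- compare with `6^{-1/2} s^{-3/2}` on `Ioi 1`
  have hg_int : IntegrableOn (fun s : ℝ => s ^ (-(3 / 2) : ℝ)) (Ioi (1 : ℝ)) :=
    integrableOn_Ioi_rpow_of_lt (by norm_num) one_pos
  have h2 : ∫ s in Ioi (1 : ℝ), (Real.sqrt 6)⁻¹ * s ^ (-(3 / 2) : ℝ) ≤ ∫ s in Ioi (1 : ℝ), f s := by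
    refine setIntegral_mono_on (hg_int.const_mul _) (hint.mono_set hsub) measurableSet_Ioi ?_
    intro s hs
    simp only [mem_Ioi] at hs
    have hs0 : 0 < s := by linarith
    have hp : 0 < 4 * s ^ 3 - G₂ * s - G₃ := hsub hs
    have hple : 4 * s ^ 3 - G₂ * s - G₃ ≤ 6 * s ^ 3 := by
      nlinarith [mul_pos hs0 (by nlinarith : (0 : ℝ) < s ^ 2)]
    have hs3 : 0 < 6 * s ^ 3 := by positivity
    rw [hf]
    simp only
    calc (Real.sqrt 6)⁻¹ * s ^ (-(3 / 2) : ℝ) = (Real.sqrt (6 * s ^ 3))⁻¹ := by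
          rw [Real.sqrt_mul (by norm_num : (0 : ℝ) ≤ 6), mul_inv, Real.sqrt_eq_rpow,
            Real.sqrt_eq_rpow, ← Real.rpow_natCast, ← Real.rpow_mul hs0.le, ← Real.rpow_neg hs0.le]
          norm_num
      _ ≤ (Real.sqrt (4 * s ^ 3 - G₂ * s - G₃))⁻¹ :=
          inv_anti₀ (Real.sqrt_pos.mpr hp) (Real.sqrt_le_sqrt hple)
  -- evaluate the model integral: `∫_{Ioi 1} s^{-3/2} = 2`
  have h3 : ∫ s in Ioi (1 : ℝ), (Real.sqrt 6)⁻¹ * s ^ (-(3 / 2) : ℝ) = (Real.sqrt 6)⁻¹ * 2 := by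
    rw [integral_const_mul, integral_Ioi_rpow_of_lt (by norm_num) one_pos]
    norm_num
  -- numerics: `1/2 ≤ 2/√6`
  have h6 : Real.sqrt 6 ≤ 3 := by
    rw [show (3 : ℝ) = Real.sqrt 9 by rw [show (9 : ℝ) = 3 ^ 2 by norm_num, Real.sqrt_sq (by norm_num)]]
    exact Real.sqrt_le_sqrt (by norm_num)
  have h6pos : 0 < Real.sqrt 6 := Real.sqrt_pos.mpr (by norm_num)
  have h4 : (1 / 2 : ℝ) ≤ (Real.sqrt 6)⁻¹ * 2 := by
    rw [inv_mul_eq_div, le_div_iff₀ h6pos]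
    linarith
  linarith [h1, h2, h3, h4]



/-- An integral model whose generic fibre is elliptic has non-zero integral discriminant. -/
theorem PeriodCalibration.Δ_ne_zero_of_isElliptic (W₀ : WeierstrassCurve ℤ)
    (hE : (W₀.baseChange ℚ).IsElliptic) : W₀.Δ ≠ 0 := by
  intro h0
  have h : IsUnit ((W₀.map (algebraMap ℤ ℚ)).Δ) := hE.isUnit
  rw [WeierstrassCurve.map_Δ, h0, map_zero] at h
  exact not_isUnit_zero h

/-- **WGS ⟹ PeriodLowerBound** (given the converse real-period bound `Ω ≥ c₀ (M⁺)^{-1/12}`):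
weak generalized Szpiro with a constant for all minimal models gives a polynomial lower bound for the
real period of every minimal model.  [folklore] -/
theorem periodLowerBound_of_weakGenSzpiro
    (hlow : ∃ c₀ : ℝ, 0 < c₀ ∧ ∀ W₀ : WeierstrassCurve ℤ, W₀.Δ ≠ 0 →
      c₀ * ((max |W₀.Δ| (|W₀.c₄| ^ 3) : ℤ) : ℝ) ^ (-(1 : ℝ) / 12) ≤ (W₀.baseChange ℝ).realPeriod)
    (hwgs : ∃ K C : ℝ, ∀ W₀ : WeierstrassCurve ℤ, (W₀.baseChange ℚ).IsElliptic →
      (∀ v : HeightOneSpectrum ℤ, (W₀.baseChange ℚ).IsMinimalAt v) →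
        ((max |W₀.Δ| (|W₀.c₄| ^ 3) : ℤ) : ℝ) ≤ C * (((W₀.baseChange ℚ).conductorNorm ℤ : ℕ) : ℝ) ^ K) :
    ∃ K C : ℝ, 0 < C ∧ ∀ W₀ : WeierstrassCurve ℤ, (W₀.baseChange ℚ).IsElliptic →
      (∀ v : HeightOneSpectrum ℤ, (W₀.baseChange ℚ).IsMinimalAt v) →
        C * (((W₀.baseChange ℚ).conductorNorm ℤ : ℕ) : ℝ) ^ (-K) ≤ (W₀.baseChange ℝ).realPeriod := by
  obtain ⟨c₀, hc₀, hlow⟩ := hlow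
  obtain ⟨K, C, hwgs⟩ := hwgs
  set K' : ℝ := max K 0 with hK'
  set C' : ℝ := max C 1 with hC'
  have hC'1 : 1 ≤ C' := le_max_right _ _
  have hC'0 : 0 < C' := by linarith
  refine ⟨K' / 12, c₀ * C' ^ (-(1 : ℝ) / 12), mul_pos hc₀ (Real.rpow_pos_of_pos hC'0 _),
    fun W₀ hE hmin => ?_⟩
  haveI := hE
  set n : ℝ := (((W₀.baseChange ℚ).conductorNorm ℤ : ℕ) : ℝ) with hn
  set M : ℝ := ((max |W₀.Δ| (|W₀.c₄| ^ 3) : ℤ) : ℝ) with hM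
  have hn1 : (1 : ℝ) ≤ n := by
    rw [hn]; exact_mod_cast WeierstrassCurve.conductorNorm_pos_holds (W₀.baseChange ℚ)
  have hn0 : (0 : ℝ) < n := by linarith
  have hΔ : W₀.Δ ≠ 0 := PeriodCalibration.Δ_ne_zero_of_isElliptic W₀ hE
  have hM1 : (1 : ℝ) ≤ M := by
    rw [hM]
    have h1 : (1 : ℤ) ≤ max |W₀.Δ| (|W₀.c₄| ^ 3) := le_trans (Int.one_le_abs hΔ) (le_max_left _ _)
    exact_mod_cast h1
  have hM0 : (0 : ℝ) < M := by linarith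
  -- `M ≤ C' n^{K'}`
  have hMle : M ≤ C' * n ^ K' := by
    calc M ≤ C * n ^ K := hwgs W₀ hE hmin
      _ ≤ C' * n ^ K := mul_le_mul_of_nonneg_right (le_max_left _ _) (Real.rpow_nonneg hn0.le K)
      _ ≤ C' * n ^ K' :=
          mul_le_mul_of_nonneg_left (Real.rpow_le_rpow_of_exponent_le hn1 (le_max_left _ _)) hC'0.le
  have hCn0 : 0 < C' * n ^ K' := mul_pos hC'0 (Real.rpow_pos_of_pos hn0 _)
  -- `(C' n^{K'})^{-1/12} ≤ M^{-1/12}`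
  have hanti : (C' * n ^ K') ^ (-(1 : ℝ) / 12) ≤ M ^ (-(1 : ℝ) / 12) := by
    rw [show (-(1 : ℝ) / 12) = -((1 : ℝ) / 12) by ring, Real.rpow_neg hCn0.le, Real.rpow_neg hM0.le]
    exact inv_anti₀ (Real.rpow_pos_of_pos hM0 _) (Real.rpow_le_rpow hM0.le hMle (by norm_num))
  -- split the power of the product
  have hsplit : (C' * n ^ K') ^ (-(1 : ℝ) / 12) = C' ^ (-(1 : ℝ) / 12) * n ^ (-(K' / 12)) := by
    rw [Real.mul_rpow hC'0.le (Real.rpow_nonneg hn0.le _), ← Real.rpow_mul hn0.le]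
    congr 1
    congr 1
    ring
  calc c₀ * C' ^ (-(1 : ℝ) / 12) * n ^ (-(K' / 12))
      = c₀ * (C' * n ^ K') ^ (-(1 : ℝ) / 12) := by rw [hsplit, mul_assoc]
    _ ≤ c₀ * M ^ (-(1 : ℝ) / 12) := mul_le_mul_of_nonneg_left hanti hc₀.le
    _ ≤ (W₀.baseChange ℝ).realPeriod := hlow W₀ hΔ

/-- **Converse real-period bound.**  For every integral model with `Δ ≠ 0`:
`(M⁺)^{-1/12} ≤ Ω(W₀ ⊗ ℝ)`, `M⁺ = max(|Δ|, |c₄|³)` — from the scaling reduction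
`Ω = 2u⁻¹∫_{p>0}p^{-1/2}` (`RealPeriodUpperBound.realPeriod_eq_scaled`, landed with stub D), the absolute
lower bound `1/2 ≤ ∫_{p>0}p^{-1/2}` (`normalizedPeriodIntegral_lower`) and `u¹² ≤ M⁺`. [folklore] -/
theorem realPeriodLowerBound :
    ∃ c₀ : ℝ, 0 < c₀ ∧ ∀ W₀ : WeierstrassCurve ℤ, W₀.Δ ≠ 0 →
      c₀ * ((max |W₀.Δ| (|W₀.c₄| ^ 3) : ℤ) : ℝ) ^ (-(1 : ℝ) / 12) ≤ (W₀.baseChange ℝ).realPeriod := by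
  refine ⟨1, one_pos, fun W₀ hΔ => ?_⟩
  obtain ⟨u, G₂, G₃, hu0, hG₂, hG₃, -, hD0, hlow, -, -, hΩ⟩ :=
    Summit.ABC.ABC.Theorems.RealPeriodUpperBound.realPeriod_eq_scaled W₀ hΔ
  have hI := normalizedPeriodIntegral_lower G₂ G₃ hG₂ hG₃ hD0
  set M : ℝ := ((max |W₀.Δ| (|W₀.c₄| ^ 3) : ℤ) : ℝ) with hM
  have hu12 : 0 < u ^ 12 := by positivity
  have hM0 : 0 < M := lt_of_lt_of_le hu12 hlow
  -- `M^{-1/12} ≤ (u¹²)^{-1/12} = u⁻¹`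
  have h1 : M ^ (-(1 : ℝ) / 12) ≤ (u ^ 12) ^ (-(1 : ℝ) / 12) := by
    rw [show (-(1 : ℝ) / 12) = -((1 : ℝ) / 12) by ring, Real.rpow_neg hM0.le, Real.rpow_neg hu12.le]
    exact inv_anti₀ (Real.rpow_pos_of_pos hu12 _) (Real.rpow_le_rpow hu12.le hlow (by norm_num))
  have h2 : (u ^ 12 : ℝ) ^ (-(1 : ℝ) / 12) = u⁻¹ := by
    rw [← Real.rpow_natCast, ← Real.rpow_mul hu0.le, ← Real.rpow_neg_one]; norm_num
  have h3 : 0 ≤ u⁻¹ := inv_nonneg.mpr hu0.le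
  calc 1 * M ^ (-(1 : ℝ) / 12) ≤ u⁻¹ := by rw [one_mul, ← h2]; exact h1
    _ ≤ 2 * u⁻¹ *
        ∫ s in {s : ℝ | 0 < 4 * s ^ 3 - G₂ * s - G₃}, (Real.sqrt (4 * s ^ 3 - G₂ * s - G₃))⁻¹ := by
          nlinarith
    _ = (W₀.baseChange ℝ).realPeriod := hΩ.symm

/-- **WGS ⟹ PeriodLowerBound, unconditionally** (the converse real-period bound discharged). -/
theorem periodLowerBound_of_weakGenSzpiro'
    (hwgs : ∃ K C : ℝ, ∀ W₀ : WeierstrassCurve ℤ, (W₀.baseChange ℚ).IsElliptic →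
      (∀ v : HeightOneSpectrum ℤ, (W₀.baseChange ℚ).IsMinimalAt v) →
        ((max |W₀.Δ| (|W₀.c₄| ^ 3) : ℤ) : ℝ) ≤ C * (((W₀.baseChange ℚ).conductorNorm ℤ : ℕ) : ℝ) ^ K) :
    ∃ K C : ℝ, 0 < C ∧ ∀ W₀ : WeierstrassCurve ℤ, (W₀.baseChange ℚ).IsElliptic →
      (∀ v : HeightOneSpectrum ℤ, (W₀.baseChange ℚ).IsMinimalAt v) →
        C * (((W₀.baseChange ℚ).conductorNorm ℤ : ℕ) : ℝ) ^ (-K) ≤ (W₀.baseChange ℝ).realPeriod :=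
  periodLowerBound_of_weakGenSzpiro realPeriodLowerBound hwgs

/-- Real bookkeeping behind both `PeriodLowerBound ∧ A0 ⟹ WGS` and stub E: from
`C·n^{-K} ≤ Ω ≤ C₀·M^{-1/12}·log(2+M)` with `M, n ≥ 1`, `C > 0` (any real `K`) one gets
`M ≤ (C'/C)^{24} · n^{24K}` with `C' := max C₀ 1 · 24 · 3^{1/24}`. -/
theorem PeriodCalibration.max_le_of_period_bounds {C K C₀ M n Ω : ℝ} (hC : 0 < C)
    (hM : 1 ≤ M) (hn : 1 ≤ n) (hlow : C * n ^ (-K) ≤ Ω)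
    (hup : Ω ≤ C₀ * M ^ (-(1 : ℝ) / 12) * Real.log (2 + M)) :
    M ≤ ((max C₀ 1 * 24 * (3 : ℝ) ^ ((1 : ℝ) / 24)) / C) ^ (24 : ℕ) * n ^ (24 * K) := by
  have hM0 : 0 < M := by linarith
  have hn0 : 0 < n := by linarith
  set C₁ : ℝ := max C₀ 1 with hC₁
  have hC₁1 : 1 ≤ C₁ := le_max_right _ _
  have h312 : 0 < (3 : ℝ) ^ ((1 : ℝ) / 24) := Real.rpow_pos_of_pos (by norm_num) _
  set C' : ℝ := C₁ * 24 * (3 : ℝ) ^ ((1 : ℝ) / 24) with hC'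
  have hC'0 : 0 < C' := by positivity
  -- `log(2+M) ≤ 24 (2+M)^{1/24} ≤ 24·3^{1/24} M^{1/24}`
  have hlog : Real.log (2 + M) ≤ 24 * (3 : ℝ) ^ ((1 : ℝ) / 24) * M ^ ((1 : ℝ) / 24) := by
    have h1 : Real.log (2 + M) ≤ (2 + M) ^ ((1 : ℝ) / 24) / ((1 : ℝ) / 24) :=
      Real.log_le_rpow_div (by linarith) (by norm_num)
    have h2 : (2 + M) ^ ((1 : ℝ) / 24) ≤ (3 * M) ^ ((1 : ℝ) / 24) :=
      Real.rpow_le_rpow (by linarith) (by linarith) (by norm_num)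
    rw [Real.mul_rpow (by norm_num) hM0.le] at h2
    rw [div_eq_mul_inv, show ((1 : ℝ) / 24)⁻¹ = 24 by norm_num] at h1
    nlinarith
  have hlog0 : 0 ≤ Real.log (2 + M) := Real.log_nonneg (by linarith)
  have hMpow : 0 < M ^ (-(1 : ℝ) / 12) := Real.rpow_pos_of_pos hM0 _
  -- `Ω ≤ C' M^{-1/24}`
  have hup' : Ω ≤ C' * M ^ (-(1 : ℝ) / 24) := by
    have h1 : C₀ * M ^ (-(1 : ℝ) / 12) * Real.log (2 + M) ≤
        C₁ * M ^ (-(1 : ℝ) / 12) * Real.log (2 + M) := by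
      apply mul_le_mul_of_nonneg_right _ hlog0
      exact mul_le_mul_of_nonneg_right (le_max_left _ _) hMpow.le
    have h2 : C₁ * M ^ (-(1 : ℝ) / 12) * Real.log (2 + M) ≤
        C₁ * M ^ (-(1 : ℝ) / 12) * (24 * (3 : ℝ) ^ ((1 : ℝ) / 24) * M ^ ((1 : ℝ) / 24)) :=
      mul_le_mul_of_nonneg_left hlog (by positivity)
    have h3 : C₁ * M ^ (-(1 : ℝ) / 12) * (24 * (3 : ℝ) ^ ((1 : ℝ) / 24) * M ^ ((1 : ℝ) / 24)) =
        C' * M ^ (-(1 : ℝ) / 24) := by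
      have : M ^ (-(1 : ℝ) / 12) * M ^ ((1 : ℝ) / 24) = M ^ (-(1 : ℝ) / 24) := by
        rw [← Real.rpow_add hM0]; norm_num
      rw [hC', ← this]; ring
    linarith
  -- combine: `C n^{-K} ≤ C' M^{-1/24}` ⇒ `M^{1/24} ≤ (C'/C) n^K`
  have hcomb : C * n ^ (-K) ≤ C' * M ^ (-(1 : ℝ) / 24) := le_trans hlow hup'
  have hnK : 0 < n ^ K := Real.rpow_pos_of_pos hn0 _
  have hM24 : 0 < M ^ ((1 : ℝ) / 24) := Real.rpow_pos_of_pos hM0 _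
  have hkey : M ^ ((1 : ℝ) / 24) ≤ C' / C * n ^ K := by
    rw [Real.rpow_neg hn0.le, show (-(1 : ℝ) / 24) = -((1 : ℝ) / 24) by ring,
      Real.rpow_neg hM0.le] at hcomb
    -- hcomb : C * (n^K)⁻¹ ≤ C' * (M^{1/24})⁻¹
    rw [div_mul_eq_mul_div, le_div_iff₀ hC]
    have h1 : C * (n ^ K)⁻¹ * (n ^ K * M ^ ((1 : ℝ) / 24)) ≤
        C' * (M ^ ((1 : ℝ) / 24))⁻¹ * (n ^ K * M ^ ((1 : ℝ) / 24)) :=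
      mul_le_mul_of_nonneg_right hcomb (by positivity)
    have h2 : C * (n ^ K)⁻¹ * (n ^ K * M ^ ((1 : ℝ) / 24)) = M ^ ((1 : ℝ) / 24) * C := by
      field_simp
    have h3 : C' * (M ^ ((1 : ℝ) / 24))⁻¹ * (n ^ K * M ^ ((1 : ℝ) / 24)) = C' * n ^ K := by
      field_simp
    linarith
  -- raise to the 24th power
  have hCC : 0 ≤ C' / C * n ^ K := by positivity
  have h24 : (M ^ ((1 : ℝ) / 24)) ^ (24 : ℕ) ≤ (C' / C * n ^ K) ^ (24 : ℕ) :=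
    pow_le_pow_left₀ hM24.le hkey 24
  have hM' : (M ^ ((1 : ℝ) / 24)) ^ (24 : ℕ) = M := by
    rw [← Real.rpow_natCast, ← Real.rpow_mul hM0.le]; norm_num
  have hR : (C' / C * n ^ K) ^ (24 : ℕ) = (C' / C) ^ (24 : ℕ) * n ^ (24 * K) := by
    rw [mul_pow, ← Real.rpow_natCast (n ^ K), ← Real.rpow_mul hn0.le]
    congr 1; congr 1; push_cast; ring
  rw [hM'] at h24
  rw [hC'] at hR
  rw [hR] at h24
  exact h24

/-- **PeriodLowerBound ∧ A0 ⟹ WGS (weak generalized Szpiro with a constant, ALL minimal models).**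
Together with `periodLowerBound_of_weakGenSzpiro'` this is the kernel-checked calibration
`PeriodLowerBound ↔ WeakGeneralizedSzpiro` modulo A0 (`RealPeriodUpperBound`, stub D of the line). -/
theorem weakGenSzpiro_of_periodBounds
    (hA0 : ∃ C₀ : ℝ, ∀ W₀ : WeierstrassCurve ℤ, W₀.Δ ≠ 0 →
      (W₀.baseChange ℝ).realPeriod ≤
        C₀ * ((max |W₀.Δ| (|W₀.c₄| ^ 3) : ℤ) : ℝ) ^ (-(1 : ℝ) / 12) *
          Real.log (2 + ((max |W₀.Δ| (|W₀.c₄| ^ 3) : ℤ) : ℝ)))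
    (hPLB : ∃ K C : ℝ, 0 < C ∧ ∀ W₀ : WeierstrassCurve ℤ, (W₀.baseChange ℚ).IsElliptic →
      (∀ v : HeightOneSpectrum ℤ, (W₀.baseChange ℚ).IsMinimalAt v) →
        C * (((W₀.baseChange ℚ).conductorNorm ℤ : ℕ) : ℝ) ^ (-K) ≤ (W₀.baseChange ℝ).realPeriod) :
    ∃ K C : ℝ, ∀ W₀ : WeierstrassCurve ℤ, (W₀.baseChange ℚ).IsElliptic →
      (∀ v : HeightOneSpectrum ℤ, (W₀.baseChange ℚ).IsMinimalAt v) →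
        ((max |W₀.Δ| (|W₀.c₄| ^ 3) : ℤ) : ℝ) ≤ C * (((W₀.baseChange ℚ).conductorNorm ℤ : ℕ) : ℝ) ^ K := by
  obtain ⟨C₀, hA0⟩ := hA0
  obtain ⟨K, C, hC, hPLB⟩ := hPLB
  refine ⟨24 * K, ((max C₀ 1 * 24 * (3 : ℝ) ^ ((1 : ℝ) / 24)) / C) ^ (24 : ℕ), fun W₀ hE hmin => ?_⟩
  haveI := hE
  have hn1 : (1 : ℝ) ≤ (((W₀.baseChange ℚ).conductorNorm ℤ : ℕ) : ℝ) := by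
    exact_mod_cast WeierstrassCurve.conductorNorm_pos_holds (W₀.baseChange ℚ)
  have hΔ : W₀.Δ ≠ 0 := PeriodCalibration.Δ_ne_zero_of_isElliptic W₀ hE
  have hM1 : (1 : ℝ) ≤ ((max |W₀.Δ| (|W₀.c₄| ^ 3) : ℤ) : ℝ) := by
    have h1 : (1 : ℤ) ≤ max |W₀.Δ| (|W₀.c₄| ^ 3) := le_trans (Int.one_le_abs hΔ) (le_max_left _ _)
    exact_mod_cast h1
  exact PeriodCalibration.max_le_of_period_bounds hC hM1 hn1 (hPLB W₀ hE hmin) (hA0 W₀ hΔ)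


/-- **STUB `stub_periodCalibration` (registered calibration stub of line `Sketch`).**  Given A0
(`RealPeriodUpperBound`, landed as `stub_realPeriodUpperBound` modulo the analytic stubs), the period
lower bound `PeriodLowerBound` is EQUIVALENT to weak generalized Szpiro with a constant for all
minimal models (`WeakGeneralizedSzpiro`, the hypothesis of the landed
`someWindowSaving_of_weakGenSzpiro`): ⟹ by `weakGenSzpiro_of_periodBounds`, ⟸ unconditionally by
`periodLowerBound_of_weakGenSzpiro'`.  This is the disprover's calibration target
"`PeriodLowerBound ↔ CofiniteWeakGenSzpiro` (A0 and its converse)" made exact: the period face of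
card A carries exactly the content of weak generalized Szpiro. -/
theorem stub_periodCalibration :
    (∃ C₀ : ℝ, ∀ W₀ : WeierstrassCurve ℤ, W₀.Δ ≠ 0 → (W₀.baseChange ℝ).realPeriod ≤
      C₀ * ((max |W₀.Δ| (|W₀.c₄| ^ 3) : ℤ) : ℝ) ^ (-(1 : ℝ) / 12) *
        Real.log (2 + ((max |W₀.Δ| (|W₀.c₄| ^ 3) : ℤ) : ℝ))) →
    ((∃ K C : ℝ, 0 < C ∧ ∀ W₀ : WeierstrassCurve ℤ, (W₀.baseChange ℚ).IsElliptic →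
      (∀ v : IsDedekindDomain.HeightOneSpectrum ℤ, (W₀.baseChange ℚ).IsMinimalAt v) →
        C * (((W₀.baseChange ℚ).conductorNorm ℤ : ℕ) : ℝ) ^ (-K) ≤ (W₀.baseChange ℝ).realPeriod) ↔
    (∃ K C : ℝ, ∀ W₀ : WeierstrassCurve ℤ, (W₀.baseChange ℚ).IsElliptic →
      (∀ v : IsDedekindDomain.HeightOneSpectrum ℤ, (W₀.baseChange ℚ).IsMinimalAt v) →
        ((max |W₀.Δ| (|W₀.c₄| ^ 3) : ℤ) : ℝ) ≤
          C * (((W₀.baseChange ℚ).conductorNorm ℤ : ℕ) : ℝ) ^ K)) :=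
  fun hA0 => ⟨weakGenSzpiro_of_periodBounds hA0, periodLowerBound_of_weakGenSzpiro'⟩


end CalInline

/-! ## The registered stubs (signatures spelled out in full; `sorry` only here) -/

/-- STUB B1 (M, LANDED p103472) — first-derivative sublevel estimate.  PLAN: resultant identity
`(−18G₂s + 27G₃)·p(s) + (6G₂s² − 9G₃s − G₂²)·p'(s) = G₂³ − 27G₃²` (ring), so on
`{s ∈ [−2,2] : |p| ≤ η}` with `η ≤ |D|/126`: `|p'| ≥ |D|/86`; `p` is strictly monotone on each of
the ≤ 3 intervals cut out of `[−2,2]` by the roots `±√(G₂/12)` of `p' = 12s² − G₂`; on each piece the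
slice is an interval (preimage of `(0,η)` under a monotone map) of length `≤ η/(|D|/86)` by the mean
value theorem; so the volume is `≤ 258 η/|D|` (`c₁ = 1/126`, `C₁ = 258`). -/
theorem stub_sublevelSmall :
    ∃ c₁ C₁ : ℝ, 0 < c₁ ∧ 0 < C₁ ∧ ∀ G₂ G₃ η : ℝ, |G₂| ≤ 1 → |G₃| ≤ 1 → 0 < η →
      η ≤ c₁ * |G₂ ^ 3 - 27 * G₃ ^ 2| →
        volume {s : ℝ | s ∈ Set.Icc (-2 : ℝ) 2 ∧ 0 < 4 * s ^ 3 - G₂ * s - G₃ ∧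
            4 * s ^ 3 - G₂ * s - G₃ < η} ≤
          ENNReal.ofReal (C₁ * η / |G₂ ^ 3 - 27 * G₃ ^ 2|) :=
  -- CLOSED: landed p103472 (worker B1, wave 1); discharged by the tree theorem of the same name.
  Summit.ABC.ABC.Theorems.stub_sublevelSmall

/-- STUB B2 (M, LANDED p102920) — square-root sublevel estimate for normalized cubics.  PLAN: exact
finite differences of the cubic `p(s) = 4s³ − G₂s − G₃`: `p(m+h) − p(m−h) = 2h(12m² − G₂) + 8h³`,
`p(m+h) + p(m−h) − 2p(m) = 24 m h²`; for a closed interval `[m−h, m+h]` inside the slice (all three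
values in `(0,η)`): if `|m| ≥ 1/10` then `24|m|h² < 2η`; if `|m| < 1/10` then `|G₃| = 1` is impossible
for `η ≤ 1/4` (`|p(m)| ≥ 1 − 0.104`), `G₂ = −1` gives `p' ≥ 1` hence `2h < η`, and `G₂ = 1` gives
`p'(m) ≤ −0.88` hence (`h ≤ 0.2` first, by the same identity) `1.44 h < η`; so `h ≤ √η` in all cases
for `η ≤ η₀ = 1/4`; the slice meets each of the ≤ 3 monotonicity pieces of `p` in an interval, so its
volume is `≤ 3 · 2√η`. -/
theorem stub_sublevelSqrt :
    ∃ η₀ C₂ : ℝ, 0 < η₀ ∧ 0 < C₂ ∧ ∀ G₂ G₃ η : ℝ, |G₂| ≤ 1 → |G₃| ≤ 1 → (|G₂| = 1 ∨ |G₃| = 1) →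
      0 < η → η ≤ η₀ →
        volume {s : ℝ | s ∈ Set.Icc (-2 : ℝ) 2 ∧ 0 < 4 * s ^ 3 - G₂ * s - G₃ ∧
            4 * s ^ 3 - G₂ * s - G₃ < η} ≤ ENNReal.ofReal (C₂ * Real.sqrt η) :=
  -- CLOSED: landed p102920 (worker B2, wave 1); discharged by the tree theorem of the same name.
  Summit.ABC.ABC.Theorems.stub_sublevelSqrt

/-- STUB C (M, LANDED p103721) — the normalized period integral
`∫_{p>0} ds/√p ≤ A + B|log|D||`.  PLAN: `{p > 0} ⊆ (−2, ∞)` (`p ≤ 4s³ + |s| + 1 < 0` for `s ≤ −2`);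
tail `∫_{(2,∞)} ≤ ∫_2^∞ (2s³)^{-1/2} ds = 1` (`p ≥ 2s³` for `s ≥ 1`); on `[−2,2]`: `{p ≥ 1}`
contributes `≤ 4`, and the dyadic shells `E_k = {2^{-k-1} ≤ p < 2^{-k}} ⊆ slice(2^{-k})` contribute
`≤ 2^{(k+1)/2} · min(4, C₂ 2^{-k/2} [2^{-k} ≤ η₀], C₁ 2^{-k}/|D| [2^{-k} ≤ c₁|D|])`, summing to
`O(1) + 2√2·C₂·log₂(1/|D|)` (alternatively the layer-cake formula
`∫ f = ∫_0^∞ vol{f > t} dt`, `{f > t} = slice(t^{-2})`).  Integrability of `1/√p` on `{p>0}` is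
`WeierstrassCurve.integrableOn_inv_sqrt_twoTorsionPolynomial'` for the real curve
`⟨0,0,0,−G₂/4,−G₃/4⟩` (`ψ = 4s³ − G₂s − G₃`, `Δ = G₂³ − 27G₃² ≠ 0`), `|D| ≤ 28`. -/
theorem stub_normalizedPeriodIntegral :
    (∃ c₁ C₁ : ℝ, 0 < c₁ ∧ 0 < C₁ ∧ ∀ G₂ G₃ η : ℝ, |G₂| ≤ 1 → |G₃| ≤ 1 → 0 < η →
      η ≤ c₁ * |G₂ ^ 3 - 27 * G₃ ^ 2| →
        volume {s : ℝ | s ∈ Set.Icc (-2 : ℝ) 2 ∧ 0 < 4 * s ^ 3 - G₂ * s - G₃ ∧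
            4 * s ^ 3 - G₂ * s - G₃ < η} ≤
          ENNReal.ofReal (C₁ * η / |G₂ ^ 3 - 27 * G₃ ^ 2|)) →
    (∃ η₀ C₂ : ℝ, 0 < η₀ ∧ 0 < C₂ ∧ ∀ G₂ G₃ η : ℝ, |G₂| ≤ 1 → |G₃| ≤ 1 → (|G₂| = 1 ∨ |G₃| = 1) →
      0 < η → η ≤ η₀ →
        volume {s : ℝ | s ∈ Set.Icc (-2 : ℝ) 2 ∧ 0 < 4 * s ^ 3 - G₂ * s - G₃ ∧
            4 * s ^ 3 - G₂ * s - G₃ < η} ≤ ENNReal.ofReal (C₂ * Real.sqrt η)) →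
    ∃ A B : ℝ, 0 ≤ A ∧ 0 ≤ B ∧ ∀ G₂ G₃ : ℝ, |G₂| ≤ 1 → |G₃| ≤ 1 → (|G₂| = 1 ∨ |G₃| = 1) →
      G₂ ^ 3 - 27 * G₃ ^ 2 ≠ 0 →
        ∫ s in {s : ℝ | 0 < 4 * s ^ 3 - G₂ * s - G₃}, (Real.sqrt (4 * s ^ 3 - G₂ * s - G₃))⁻¹ ≤
          A + B * |Real.log (|G₂ ^ 3 - 27 * G₃ ^ 2|)| :=
  -- CLOSED: landed p103721 (worker C, wave 1); discharged by the tree theorem of the same name.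
  Summit.ABC.ABC.Theorems.stub_normalizedPeriodIntegral

/-- STUB D (M, LANDED p102858) — A0 by shift + scaling.  PLAN: for
`W := W₀ ⊗ ℝ`, `ψ(x) = 4x³ + b₂x² + 2b₄x + b₆` (`eval_twoTorsionPolynomial`) and
`ψ(t − b₂/12) = 4t³ − g₂ t − g₃` with `g₂ = c₄/12`, `g₃ = c₆/216` (ring; `c₄ = b₂² − 24b₄`,
`c₆ = −b₂³ + 36b₂b₄ − 216b₆`); with `H > 0`, `H⁶ = max(|g₂|³, g₃²)` and `t = H s`:
`4t³ − g₂t − g₃ = H³ · p(s)`, `p = 4s³ − G₂s − G₃`, `G₂ = g₂/H²`, `G₃ = g₃/H³` normalized, so by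
translation invariance and `Measure.integral_comp_mul_left` (pattern of `realPeriod_smul_holds`, no
integrability needed) `Ω(W) = 2∫_{ψ>0}(√ψ)⁻¹ = 2 H^{-1/2} ∫_{p>0} (√p)⁻¹ ≤ 2H^{-1/2}(A + B|log|D||)`
with `D = G₂³ − 27G₃² = Δ/H⁶` (`Δ = g₂³ − 27g₃²`, `map_Δ`, `map_c₄`).  Bookkeeping with
`M = max(|Δ|,|c₄|³) ≥ 1` (`Δ ∈ ℤ ∖ {0}`): `|c₄|³ = 1728|g₂|³`, `c₆² = c₄³ − 1728Δ ≤ 1729 M`, hence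
`H⁶ ≤ M ≤ 1728 H⁶`, `1/M ≤ |D| ≤ 28`, `|log|D|| ≤ log 28 + log M`, `log(2+M) ≥ log 3 ≥ 1`. -/
theorem stub_realPeriodUpperBound :
    (∃ A B : ℝ, 0 ≤ A ∧ 0 ≤ B ∧ ∀ G₂ G₃ : ℝ, |G₂| ≤ 1 → |G₃| ≤ 1 → (|G₂| = 1 ∨ |G₃| = 1) →
      G₂ ^ 3 - 27 * G₃ ^ 2 ≠ 0 →
        ∫ s in {s : ℝ | 0 < 4 * s ^ 3 - G₂ * s - G₃}, (Real.sqrt (4 * s ^ 3 - G₂ * s - G₃))⁻¹ ≤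
          A + B * |Real.log (|G₂ ^ 3 - 27 * G₃ ^ 2|)|) →
    ∃ C₀ : ℝ, ∀ W₀ : WeierstrassCurve ℤ, W₀.Δ ≠ 0 →
      (W₀.baseChange ℝ).realPeriod ≤
        C₀ * ((max |W₀.Δ| (|W₀.c₄| ^ 3) : ℤ) : ℝ) ^ (-(1 : ℝ) / 12) *
          Real.log (2 + ((max |W₀.Δ| (|W₀.c₄| ^ 3) : ℤ) : ℝ)) :=
  -- CLOSED: landed p102858 (worker D, wave 1); discharged by the tree theorem of the same name.
  Summit.ABC.ABC.Theorems.stub_realPeriodUpperBound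

/-- STUB E (S/M, LANDED p102705) — A0 ∧ A1 ⟹ cofinite weak generalized Szpiro.  PLAN: for a minimal
model, `W₀.Δ ≠ 0` (`map_Δ`, `IsElliptic` over `ℚ`), `M := max(|Δ|,|c₄|³) ≥ 1`,
`N ≥ 1` (`conductorNorm_pos_holds`); WLOG `K ≥ 0`, `C₀ ≥ 0` (else `Ω ≤ 0 < C N^{-K}`);
`log(2+M) ≤ 24 (2+M)^{1/24} ≤ 24·3^{1/24} M^{1/24}` (`Real.log_le_rpow_div`), so
`C N^{-K} ≤ Ω ≤ C' M^{-1/24}`, i.e. `M ≤ (C'/C)^{24} N^{24K} ≤ N^{24K+1}` once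
`N ≥ N₀ := max 2 ((C'/C)^{24})`. -/
theorem stub_cofiniteOfPeriodBounds :
    (∃ C₀ : ℝ, ∀ W₀ : WeierstrassCurve ℤ, W₀.Δ ≠ 0 →
      (W₀.baseChange ℝ).realPeriod ≤
        C₀ * ((max |W₀.Δ| (|W₀.c₄| ^ 3) : ℤ) : ℝ) ^ (-(1 : ℝ) / 12) *
          Real.log (2 + ((max |W₀.Δ| (|W₀.c₄| ^ 3) : ℤ) : ℝ))) →
    (∃ K C : ℝ, 0 < C ∧ ∀ W₀ : WeierstrassCurve ℤ, (W₀.baseChange ℚ).IsElliptic →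
      (∀ v : HeightOneSpectrum ℤ, (W₀.baseChange ℚ).IsMinimalAt v) →
        C * (((W₀.baseChange ℚ).conductorNorm ℤ : ℕ) : ℝ) ^ (-K) ≤ (W₀.baseChange ℝ).realPeriod) →
    ∃ K N₀ : ℝ, ∀ W₀ : WeierstrassCurve ℤ, (W₀.baseChange ℚ).IsElliptic →
      (∀ v : HeightOneSpectrum ℤ, (W₀.baseChange ℚ).IsMinimalAt v) → W₀.c₄ ≠ 0 → W₀.c₆ ≠ 0 →
        N₀ ≤ (((W₀.baseChange ℚ).conductorNorm ℤ : ℕ) : ℝ) →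
          ((max |W₀.Δ| (|W₀.c₄| ^ 3) : ℤ) : ℝ) ≤
            (((W₀.baseChange ℚ).conductorNorm ℤ : ℕ) : ℝ) ^ K :=
  -- CLOSED: landed p102705 (worker E, wave 1); discharged by the tree theorem of the same name.
  Summit.ABC.ABC.Theorems.stub_cofiniteOfPeriodBounds

/-- STUB K1 (XL, OPEN — the honest open core, the lead's stub) — `PolyAlgebraicPart`.  For every
minimal model there is an admissible `D ≤ N^A` with `L(E_D,1) ≥ N^{-B}` and integers `m ≥ 1`, `a`
with `m·L(E_D,1)·√D = a·Ω(E)` and `|a| ≤ C N^K`.  By BSD in analytic rank 0,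
`a = m·#Ш(E_D)·Tam/#tors²`: a polynomial bound for `Ш` of ONE small rank-zero twist (Goldfeld–Szpiro
direction `Ш ⇒ Szpiro`).  Weak-abc strength: K1 ⟹ `PeriodLowerBound` (proved below) ⟹ (A0)
cofinite WGS ⟺ crux (`Disproof.lean` §1); every known upper bound for the algebraic part is BY the
`L/Ω` ratio (Kolyvagin, Kato), hence circular for a violator (ideator's "honest wall", N3). -/
theorem stub_polyAlgebraicPart :
    ∃ A B K C : ℝ, 0 < C ∧ ∀ W₀ : WeierstrassCurve ℤ, (W₀.baseChange ℚ).IsElliptic →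
      (∀ v : HeightOneSpectrum ℤ, (W₀.baseChange ℚ).IsMinimalAt v) →
        ∃ D : ℤ, (0 < D ∧ Squarefree D ∧ D ≡ 1 [ZMOD 4] ∧
            IsCoprime D (6 * ((W₀.baseChange ℚ).conductorNorm ℤ : ℤ))) ∧
          (D : ℝ) ≤ (((W₀.baseChange ℚ).conductorNorm ℤ : ℕ) : ℝ) ^ A ∧
          (((W₀.baseChange ℚ).conductorNorm ℤ : ℕ) : ℝ) ^ (-B) ≤
            (((W₀.baseChange ℚ).quadraticTwist (D : ℚ)).entireLFunction 1).re ∧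
          ∃ (m : ℕ) (a : ℤ), 0 < m ∧
            (m : ℝ) * (((W₀.baseChange ℚ).quadraticTwist (D : ℚ)).entireLFunction 1).re *
                Real.sqrt D = a * (W₀.baseChange ℝ).realPeriod ∧
            (|a| : ℝ) ≤ C * (((W₀.baseChange ℚ).conductorNorm ℤ : ℕ) : ℝ) ^ K := by
  sorry

/-- STUB CAL (S, LANDED p106567, lead a2; CALIBRATION stub — not an input of
`SomeWindowSaving_of`) — `RealPeriodUpperBound → (PeriodLowerBound ↔ WeakGeneralizedSzpiro)`: the
period face of card A carries EXACTLY the content of weak generalized Szpiro (with a constant, all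
minimal models).  ⟹: `log(2+M) ≤ 24(3M)^{1/24}` bookkeeping for all `N` (no cofinite threshold);
⟸: the CONVERSE real-period bound `Ω ≥ (M⁺)^{-1/12}` (scaling reduction + `∫_1^∞(6s³)^{-1/2} ≥ 1/2`),
unconditional.  With STUBS B1, B2, C (A0) this gives `K1 ⟹ WGS` for ALL curves. -/
theorem stub_periodCalibration :
    (∃ C₀ : ℝ, ∀ W₀ : WeierstrassCurve ℤ, W₀.Δ ≠ 0 → (W₀.baseChange ℝ).realPeriod ≤
      C₀ * ((max |W₀.Δ| (|W₀.c₄| ^ 3) : ℤ) : ℝ) ^ (-(1 : ℝ) / 12) *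
        Real.log (2 + ((max |W₀.Δ| (|W₀.c₄| ^ 3) : ℤ) : ℝ))) →
    ((∃ K C : ℝ, 0 < C ∧ ∀ W₀ : WeierstrassCurve ℤ, (W₀.baseChange ℚ).IsElliptic →
      (∀ v : IsDedekindDomain.HeightOneSpectrum ℤ, (W₀.baseChange ℚ).IsMinimalAt v) →
        C * (((W₀.baseChange ℚ).conductorNorm ℤ : ℕ) : ℝ) ^ (-K) ≤ (W₀.baseChange ℝ).realPeriod) ↔
    (∃ K C : ℝ, ∀ W₀ : WeierstrassCurve ℤ, (W₀.baseChange ℚ).IsElliptic →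
      (∀ v : IsDedekindDomain.HeightOneSpectrum ℤ, (W₀.baseChange ℚ).IsMinimalAt v) →
        ((max |W₀.Δ| (|W₀.c₄| ^ 3) : ℤ) : ℝ) ≤
          C * (((W₀.baseChange ℚ).conductorNorm ℤ : ℕ) : ℝ) ^ K)) :=
  -- CLOSED: landed p106567 (lead a2) as `Summit.ABC.ABC.Theorems.stub_periodCalibration`
  -- (Theorems/TwistAmplificationSomeWindowSavingPeriodCalibration.lean); discharged here by the VERBATIM inlined copy
  -- `CalInline.stub_periodCalibration` below-namespace (the farm had not rebuilt the landed module when this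
  -- workfile was published; swap for the tree name once `import …PeriodCalibration` elaborates).
  CalInline.stub_periodCalibration

/-! ### Consistency: each named statement IS its registered stub (definitionally) -/

theorem sublevelSmall_holds : SublevelSmall := stub_sublevelSmall
theorem sublevelSqrt_holds : SublevelSqrt := stub_sublevelSqrt
theorem normalizedPeriodBound_holds : SublevelSmall → SublevelSqrt → NormalizedPeriodBound :=
  stub_normalizedPeriodIntegral
theorem realPeriodUpperBound_holds : NormalizedPeriodBound → RealPeriodUpperBound :=
  stub_realPeriodUpperBound
theorem cofiniteOfPeriodBounds_holds :
    RealPeriodUpperBound → PeriodLowerBound → CofiniteWeakGenSzpiro :=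
  stub_cofiniteOfPeriodBounds
theorem polyAlgebraicPart_holds : PolyAlgebraicPart := stub_polyAlgebraicPart
theorem periodCalibration_holds :
    RealPeriodUpperBound → (PeriodLowerBound ↔ WeakGeneralizedSzpiro) :=
  stub_periodCalibration

/-! ### Name-keyed aliases of the stub statements (hypotheses of the composition) -/
namespace Registered

/-- Alias of (B1) keyed by the registered stub name. -/
abbrev stub_sublevelSmall : Prop := SublevelSmall
/-- Alias of (B2) keyed by the registered stub name. -/
abbrev stub_sublevelSqrt : Prop := SublevelSqrt
/-- Alias of (C) keyed by the registered stub name. -/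
abbrev stub_normalizedPeriodIntegral : Prop := SublevelSmall → SublevelSqrt → NormalizedPeriodBound
/-- Alias of (D) keyed by the registered stub name. -/
abbrev stub_realPeriodUpperBound : Prop := NormalizedPeriodBound → RealPeriodUpperBound
/-- Alias of (E) keyed by the registered stub name. -/
abbrev stub_cofiniteOfPeriodBounds : Prop :=
  RealPeriodUpperBound → PeriodLowerBound → CofiniteWeakGenSzpiro
/-- Alias of (K1) keyed by the registered stub name. -/
abbrev stub_polyAlgebraicPart : Prop := PolyAlgebraicPart
/-- Alias of (CAL) keyed by the registered stub name. -/
abbrev stub_periodCalibration : Prop :=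
  RealPeriodUpperBound → (PeriodLowerBound ↔ WeakGeneralizedSzpiro)

end Registered

/-! ## Proved glue -/

/-- The real period of any real model is `≥ 0` (integral of a non-negative function; junk `0`). -/
theorem realPeriodZ_nonneg (W₀ : WeierstrassCurve ℤ) : 0 ≤ realPeriodZ W₀ := by
  unfold realPeriodZ WeierstrassCurve.realPeriod
  refine mul_nonneg (by norm_num) (setIntegral_nonneg (W₀.baseChange ℝ).measurableSet_twoTorsionSet ?_)
  intro x _
  exact inv_nonneg.mpr (Real.sqrt_nonneg _)

/-- The conductor of an elliptic generic fibre is `≥ 1` as a real number. -/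
theorem one_le_condR (W₀ : WeierstrassCurve ℤ) (hE : (W₀.baseChange ℚ).IsElliptic) :
    (1 : ℝ) ≤ condR W₀ := by
  haveI := hE
  have h : 0 < (W₀.baseChange ℚ).conductorNorm ℤ :=
    WeierstrassCurve.conductorNorm_pos_holds (W₀.baseChange ℚ)
  unfold condR
  exact_mod_cast h

/-- **FIRST LEMMA of card A (KERNEL-CHECKED): `PolyAlgebraicPart → PeriodLowerBound`.**
Pure real algebra: `Ω = m L √D / a` with `m ≥ 1`, `L ≥ N^{-B}`, `√D ≥ 1`, `0 < a ≤ C N^K`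
(positivity of `a` from `Ω ≥ 0` and `m L √D > 0`), hence `Ω ≥ C⁻¹ N^{-(B+K)}`.
(Ideator 5's proof, adapted to the curried hypotheses.) -/
theorem periodLowerBound_of_polyAlgebraicPart (h : PolyAlgebraicPart) : PeriodLowerBound := by
  obtain ⟨A, B, K, C, hC, h⟩ := h
  refine ⟨B + K, C⁻¹, inv_pos.mpr hC, fun W₀ hE hmin => ?_⟩
  obtain ⟨D, ⟨hD0, -, -, -⟩, -, hL, m, a, hm, heq, ha⟩ := h W₀ hE hmin
  have hN : (1 : ℝ) ≤ condR W₀ := one_le_condR W₀ hE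
  have hNpos : 0 < condR W₀ := by linarith
  set L : ℝ := centralValue (twistQ W₀ D) with hLdef
  set Ω : ℝ := realPeriodZ W₀ with hΩdef
  have hLpos : 0 < L := lt_of_lt_of_le (Real.rpow_pos_of_pos hNpos _) hL
  have hm1 : (1 : ℝ) ≤ m := by exact_mod_cast hm
  have hD1 : (1 : ℝ) ≤ Real.sqrt D := by
    rw [show (1 : ℝ) = Real.sqrt 1 by simp]
    exact Real.sqrt_le_sqrt (by exact_mod_cast hD0)
  have hlhs : 0 < (m : ℝ) * L * Real.sqrt D := by positivity
  have hΩ0 : 0 ≤ Ω := realPeriodZ_nonneg W₀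
  -- `a > 0`: from `a Ω = m L √D > 0` and `Ω ≥ 0`.
  have hapos : (0 : ℝ) < a := by
    rw [heq] at hlhs
    rcases lt_trichotomy (a : ℝ) 0 with ha0 | ha0 | ha0
    · nlinarith
    · rw [ha0, zero_mul] at hlhs; exact absurd hlhs (lt_irrefl _)
    · exact ha0
  have haC : (a : ℝ) ≤ C * condR W₀ ^ K := le_trans (le_abs_self _) ha
  have hD0' : 0 ≤ Real.sqrt D := Real.sqrt_nonneg _
  have hmD : 1 ≤ (m : ℝ) * Real.sqrt D := by nlinarith
  have h1 : condR W₀ ^ (-B) ≤ (m : ℝ) * L * Real.sqrt D := by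
    have : L ≤ (m : ℝ) * L * Real.sqrt D := by nlinarith
    exact le_trans hL this
  have h2 : condR W₀ ^ (-B) ≤ (a : ℝ) * Ω := by rw [← heq]; exact h1
  have h3 : condR W₀ ^ (-B) ≤ C * condR W₀ ^ K * Ω :=
    le_trans h2 (mul_le_mul_of_nonneg_right haC hΩ0)
  have hCK : 0 < C * condR W₀ ^ K := mul_pos hC (Real.rpow_pos_of_pos hNpos _)
  have h4 : condR W₀ ^ (-B) / (C * condR W₀ ^ K) ≤ Ω := by
    rw [div_le_iff₀ hCK]; linarith [mul_comm (C * condR W₀ ^ K) Ω]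
  calc C⁻¹ * condR W₀ ^ (-(B + K)) = condR W₀ ^ (-B) / (C * condR W₀ ^ K) := by
        rw [neg_add, Real.rpow_add hNpos, Real.rpow_neg hNpos.le K, div_eq_mul_inv, mul_inv]
        ring
    _ ≤ Ω := h4

/-! ## The composition: the stubs imply the crux, by name -/

/-- `SomeWindowSaving` from the stubs (pure logic; no `sorry` outside the `stub_*`): the OPEN core K1
(hypothesis) gives the period lower bound (first lemma, proved); STUBS B1, B2, C, D give the real-period
upper bound A0; STUB E turns the two period bounds into cofinite weak generalized Szpiro; the LANDED
inert box turns that into the crux. -/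
theorem SomeWindowSaving_of (hK1 : Registered.stub_polyAlgebraicPart) :
    Summit.ABC.ABC.Theses.TwistAmplification.SomeWindowSaving :=
  -- the LANDED inert box (`someWindowSaving_of_cofiniteWeakGenSzpiro`, p76658) is the entry point
  Summit.ABC.ABC.Theorems.someWindowSaving_of_cofiniteWeakGenSzpiro
    (stub_cofiniteOfPeriodBounds
      (stub_realPeriodUpperBound (stub_normalizedPeriodIntegral stub_sublevelSmall stub_sublevelSqrt))
      (periodLowerBound_of_polyAlgebraicPart hK1))

/-- Wiring check: the registered stubs feed `SomeWindowSaving_of` as stated. -/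
example : Summit.ABC.ABC.Theses.TwistAmplification.SomeWindowSaving :=
  SomeWindowSaving_of stub_polyAlgebraicPart

/-- Sanity link: the local `CofiniteWeakGenSzpiro` is literally the hypothesis of the landed InertBox. -/
example (h : CofiniteWeakGenSzpiro) : Summit.ABC.ABC.Theses.TwistAmplification.SomeWindowSaving :=
  Summit.ABC.ABC.Theorems.someWindowSaving_of_cofiniteWeakGenSzpiro h

/-! ## Calibration (PROVED — every ingredient landed): the period face IS weak generalized Szpiro -/

/-- A0 from the stubs — ALL LANDED (B1 p103472, B2 p102920, C p103721, D p102858): the real-period upper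
bound `Ω ≤ C₀ (M⁺)^{-1/12} log(2+M⁺)` is now an unconditional theorem of the tree. -/
theorem realPeriodUpperBound_of_stubs : RealPeriodUpperBound :=
  stub_realPeriodUpperBound (stub_normalizedPeriodIntegral stub_sublevelSmall stub_sublevelSqrt)

/-- **`PeriodLowerBound ↔ WeakGeneralizedSzpiro`** — UNCONDITIONAL (CAL p106567 + A0 from B1 B2 C D). -/
theorem periodLowerBound_iff_weakGenSzpiro : PeriodLowerBound ↔ WeakGeneralizedSzpiro :=
  stub_periodCalibration realPeriodUpperBound_of_stubs

/-- Hence the open core K1 gives weak generalized Szpiro for ALL minimal models (not only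
cofinitely) — K1 is at least crux-strength. -/
theorem weakGenSzpiro_of_polyAlgebraicPart (hK1 : Registered.stub_polyAlgebraicPart) :
    WeakGeneralizedSzpiro :=
  periodLowerBound_iff_weakGenSzpiro.mp (periodLowerBound_of_polyAlgebraicPart hK1)

/-- … and the crux again, through the landed `someWindowSaving_of_weakGenSzpiro`. -/
example (hK1 : Registered.stub_polyAlgebraicPart) : SomeWindowSaving :=
  Summit.ABC.ABC.Theorems.someWindowSaving_of_weakGenSzpiro (weakGenSzpiro_of_polyAlgebraicPart hK1)

/-- The ideator's NORMAL FORM OF A VIOLATOR, kernel-checked in its logical skeleton: if weak generalized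
Szpiro fails, then for every choice of exponents/constants some minimal model has NO admissible twist
`D ≤ N^A` with `L(E_D,1) ≥ N^{-B}` whose algebraic part is `≤ C N^K` — i.e. `¬ K1`.  (The arithmetic
reading `a = m·#Ш(E_D)·Tam/#tors²` is BSD in analytic rank 0 and is not formalised here.) -/
theorem not_polyAlgebraicPart_of_not_weakGenSzpiro (h : ¬ WeakGeneralizedSzpiro) :
    ¬ Registered.stub_polyAlgebraicPart :=
  fun hK1 => h (weakGenSzpiro_of_polyAlgebraicPart hK1)

/-! Disprover targets still open: an ARITHMETIC instance of the normal form (de Weger's phenomenon: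
good abc triples ⇒ Frey twists with large `Ш`), and K1 itself. -/

end Summit.ABC.ABC.Cruxes.SomeWindowSaving.Sketch

end
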